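import Summits.QuantumFields.YangMills.Theorems.BalabanUVNodesN07AtRecordTwoTierOneSided
import Literature.MathematicalPhysics.QuantumFieldTheory.Balaban1983to89.Node00.CriticalOfRecord
import Literature.MathematicalPhysics.QuantumFieldTheory.Balaban1983to89.Node00.CarriersZSectE

/-!
# BalabanUVNodes ∕ N07 ([B11]) — THE N07 CLOSERS OF RECORD AT THE CRIT-PINNED RESIDUAL LAYER `ζ.pinCrit`: «minimal ⇒ critical» (`hcrit`) DISCHARGED,
# the restriction law (`hloc`) absent — N07's node sentences with NO non-printed dictionary residual, in BOTH currencies (print's Prop-7 DAG and the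
# repaired two-tier tower)

Track A of `YM-PLAN.md` (cell `pub-ymgap`, HUMAN RULING D-0062), node **N07** = [Balaban1985Variational] Thm 1 p. 279 + Props 2–9 pp. 281–309; seat `pub-ymgap-dag-n07-e`
(generation 2; `FAN-OUT.md` §N07 row s3 continued), sixth module.  THEOREMS ONLY (0 `def`, 0 `sorry`, standard axioms); COUNT-NEUTRAL; `--supports stmt-QuantumFields-19674`.
Imports this seat's `BalabanUVNodesN07AtRecordTwoTierOneSided` (p458798; through it `…N07RestrictionLawAtObjects` p456450, `…N07SectAObjects` p454423, seat -d's
`…N07AtRecordTwoTier` p455032, n07-a's `…N07AtRecord11` p450629 ∕ `…N07AtRecordCarriersZ` p433511) and NODE 00's `Node00/CriticalOfRecord` (this seat, generation 2: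
`IsCritOfRecord`, `isCritOfRecord_of_isBackground`, `ResidZ.pinCrit`, `hcrit_pinCrit`) and `Node00/CarriersZSectE` (node00-def-B11 g2, p462651: `ResidZ.withSectE`,
`prop4_Z11OfRecord_withSectE`, `prop6_Z11OfRecord_withSectE`); nothing there is modified.

T. Bałaban, *The variational problem and background fields in renormalization group method for lattice gauge theories*, Commun. Math. Phys. **102** (1985) 277–309
[Balaban1985Variational]; p. 299 [PDF 23]: *«… this implies that U_k is a minimal configuration of the functional A(U)»*; p. 300 [PDF 24]: *«We will use only the fact
that they are critical configurations of the functional (5) and that they belong to the spaces (6) with ε₀ sufficiently small.»*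

WHAT THIS FILE DOES.  Every N07 closer of record at NODE 00's objects displays the dictionary residual
`hcrit : ∀ i e V U, IsBackground (avOfRecord F N i.K) {U | InUkClassB11 F N i.K i.k e U} i.k V U → ζ.IsCrit i V U` («minimal ⇒ critical» for the FREE criticality slot of the
residual layer `ζ : ResidZ F N`); after this seat's F-n07e-1 (p456450 ∕ p458798: `hloc` eliminated) it is the ONLY non-printed dictionary hypothesis left.  At the
crit-pinned layer `ζ.pinCrit` (`IsCrit :=` print's «critical configuration of (5) on 𝔅_k(V)», `Node00.IsCritOfRecord`) it is a THEOREM (`Node00.hcrit_pinCrit`, Fermat +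
openness of (2)), so the closers are re-run there WITHOUT it:
* §1 PRINT'S PROP-7 DAG (p. 304 assembly): `exists_thm1At_famV_pinCrit_of_prop7_prop8_sectF` — Theorem 1 at ONE block of constants over the whole Theorem-1 family of record
  `famVOfRecord F N ζ` from `Prop7Printed ∧ Prop8Printed ∧ SectFPrinted` over `famXOfRecord F N ζ.pinCrit` and `0 < B₃`, `0 < C₁` — NOTHING ELSE;
  `thm1Printed_Z11OfRecord_pinCrit_of_prop7_prop8_sectF`; the leaf forms `b11Leaf_Z11OfRecord_pinCrit_of_parts` (the nine printed parts ⇒ the leaf),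
  `thm1Printed_Z11OfRecord_pinCrit_of_prop7_leaves` ∕ `b11Leaf_Z11OfRecord_pinCrit_of_prop7_leaves` (Prop 8 and Sect. F from r08's located leaves), and the ₁₁ consumer
  `exists_record₁₁CB10YZW_b11_main_pinCrit_of_prop7_leaves`.
* §2 THE REPAIRED TWO-TIER TOWER (row s3's currency): `thm1At_prop7_famOfRecord_pinCrit_of_towerT_parts` — Theorem 1 over the family AND the background-free Proposition 7
  over `famXOfRecord F N ζ.pinCrit` from Props 2, 5, 6 over `ζ.famLG`, Prop 8 + Sect. F over `famXOfRecord F N ζ.pinCrit`, the located bridge steps (15)–(18) ∕ (112)–(142)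
  (`Bridge`, `Bridge.Laws`, `ExistenceLeavesCap`, `hbg14`) and the printed constant relations — NOTHING ELSE; `b11Leaf_Z11OfRecord_pinCrit_of_towerT_parts`,
  `exists_record₁₁CB10YZW_b11_main_pinCrit_of_towerT_parts`, `b11Leaf_Z11OfRecord_pinCrit_of_towerT_parts_kappa_one` (κ₀ = 1: the printed tower, ONE constant).
* §3 THE DOUBLY-PINNED LAYER `(ζ.withSectE E).pinCrit` (node00-def-B11's Sect.-E presentation of `famLG` AND the criticality pin; the two refinements touch disjoint fields):
  the [B11] leaf at `Z11OfRecord F N (ζ.withSectE E).pinCrit` from Props 2, 3, 5, 7, 8, Sect. F, Prop. 9 (`b11Leaf_Z11OfRecord_withSectE_pinCrit_of_parts`: p4, p6 are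
  def-B11's theorems, t1 is §1, `hcrit` ∕ `hloc` gone) and, in the tower currency, from Props 2, 3, 5, 8, Sect. F, Prop. 9 + the located bridge steps + the constant
  relations (`b11Leaf_Z11OfRecord_withSectE_pinCrit_of_towerT_parts_kappa_one`: t1 AND p7 derived); the ₁₁ consumer `exists_record₁₁CB10YZW_b11_main_withSectE_pinCrit_of_parts`.
Every proof is the corresponding `hcrit`-displaying theorem of record applied at the pinned layer with `hcrit := Node00.hcrit_pinCrit _` (the other fields are the
unpinned layer's by `rfl`), p4 ∕ p6 by `Node00.prop4∕prop6_Z11OfRecord_withSectE` (their statements over `(ζ.withSectE E).famLG` ARE the ones over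
`((ζ.withSectE E).pinCrit).famLG`, `rfl`).

WHAT STAYS DISPLAYED at the crit-pinned layer is PRINTED or LOCATED-IN-PRINT: Props 2–9 and Sect. F as typed by r2 (`B11.Prop2Printed … Prop9Printed`, `SectFPrinted`) —
resp. r08's located Sect.-F leaves —, the located bridge steps of pp. 280–299, the constant relations of pp. 279–280; their «critical» now MEANS print's notion
(`famXOfRecord_pinCrit_isCritical`).  The regularity data `R` of (9)–(10) stay residual (finding F8: genuine cubes — the one remaining object-level pin of the
[B11] group) and `famLG` ∕ `famAn` stay carriers (node00-def-B11's `CarriersZSectE`, p462651, presents `famLG` through n07-b's Sect.-E datum; the two refinements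
`withSectE` and `pinCrit` touch disjoint fields and commute).

HONEST FRAMING.  Kernel bookkeeping at NODE 00's no-holes objects: ONE displayed non-printed hypothesis of the N07 pin list DISCHARGED (by `Node00/CriticalOfRecord`),
none added; NOTHING of Sects. B–G proved; [B11] Theorem 1 for `k ≥ 1` enters only as a consequence of the displayed printed statements; N07 NOT discharged; counts 5∕27
unmoved; no object of record modified; one finite four-torus programme at fixed `ε` — NOT continuum ∕ ℝ⁴ ∕ infinite volume ∕ OS ∕ mass gap ∕ Clay.  No `def`, no
`instance`, no `notation`.
-/

noncomputable section

namespace Summit.QuantumFields.YangMills.BalabanUVNodes.N07AtRecordCritPinned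

open Literature.MathematicalPhysics.QuantumFieldTheory.Balaban1983to89
open Literature.MathematicalPhysics.QuantumFieldTheory.Balaban1983to89.T4Continuum (T4Family FiniteEpsData)
open Literature.MathematicalPhysics.QuantumFieldTheory.Balaban1983to89.DagBinding
open Literature.MathematicalPhysics.QuantumFieldTheory.Balaban1983to89.Node00
open Literature.MathematicalPhysics.QuantumFieldTheory.Balaban1983to89.B11Thm1 (Thm1At)
open Literature.MathematicalPhysics.QuantumFieldTheory.Balaban1983to89.B11Thm1CarrierT (varProblemT)
open Literature.MathematicalPhysics.QuantumFieldTheory.Balaban1983to89.B11Prop7Assembly (Bridge ExistenceLeavesCap)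
open Literature.MathematicalPhysics.QuantumFieldTheory.Balaban1983to89.B11SectFAssembly (CubeData Leaves)
open Summit.QuantumFields.YangMills.BalabanUVNodes.N07RestrictionLawAtObjects
  (exists_thm1At_famV_of_prop7_prop8_sectF thm1Printed_Z11OfRecord_of_prop7_prop8_sectF thm1Printed_Z11OfRecord_of_prop7_leaves_noLoc
    b11Leaf_Z11OfRecord_of_parts_noLoc b11Leaf_Z11OfRecord_of_prop7_leaves_noLoc exists_record₁₁CB10YZW_b11_main_of_prop7_leaves_noLoc)
open Summit.QuantumFields.YangMills.BalabanUVNodes.N07AtRecordTwoTierOneSided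
  (thm1At_prop7_famOfRecord_of_towerT_parts_noLoc b11Leaf_Z11OfRecord_of_towerT_parts_noLoc exists_record₁₁CB10YZW_b11_main_of_towerT_parts_noLoc
    b11Leaf_Z11OfRecord_of_towerT_parts_kappa_one_noLoc)
open scoped Matrix.Norms.L2Operator

variable {F : T4Family} {N : ℕ} [NeZero N]

/-! ## §0 The pinned layer: what «critical» means there, and that the displayed `hcrit` is a theorem -/

/-- At the crit-pinned layer the Props 7–8 ∕ Sect. F family's «critical» IS print's «critical configuration of (5) on 𝔅_k(V)» (`Node00.IsCritOfRecord`, `rfl`) — so the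
printed statements `Prop7Printed`, `Prop8Printed`, `SectFPrinted` over `famXOfRecord F N ζ.pinCrit` read «critical» as print does. [cite: Balaban1985Variational, Props 7–8 pp.299–304, Sect. F p.300] -/
theorem famXOfRecord_pinCrit_isCritical_iff (ζ : ResidZ F N) (i : ZIdx) (V : GaugeField (F.P i.K) i.k (SU N)) (U : GaugeField (F.P i.K) 0 (SU N)) :
    (famXOfRecord F N ζ.pinCrit i).IsCritical V U ↔ IsCritOfRecord F N i.K i.k V U := Iff.rfl

/-- **THE DISPLAYED `hcrit` OF EVERY N07 CLOSER OF RECORD, AT `ζ.pinCrit`, IS A THEOREM** (`Node00.hcrit_pinCrit`: Fermat along curves + openness of (2)) — restated here in the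
closers' binder shape for the record. [cite: Balaban1985Variational, p.299 («U_k is a minimal configuration of the functional A(U)»), p.300] -/
theorem hcrit_at_pinCrit (ζ : ResidZ F N) :
    ∀ (i : ZIdx) (e : ℝ) (V : GaugeField (F.P i.K) i.k (SU N)) (U : GaugeField (F.P i.K) 0 (SU N)),
      IsBackground (avOfRecord F N i.K) {U | InUkClassB11 F N i.K i.k e U} i.k V U → ζ.pinCrit.IsCrit i V U :=
  hcrit_pinCrit ζ

/-! ## §1 Print's Prop-7 DAG at the crit-pinned layer: Theorem 1 over the family of record from Props 7, 8, Sect. F — NOTHING ELSE -/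

section Prop7Dag

variable (ζ : ResidZ F N)

/-- ★ **THEOREM 1 AT ONE BLOCK OF CONSTANTS OVER THE WHOLE THEOREM-1 FAMILY OF RECORD ⇐ PROPOSITIONS 7, 8 AND SECT. F AT THE CRIT-PINNED LAYER — NO `hloc`, NO `hcrit`**:
p. 304's assembly re-run at NODE 00's objects (`exists_thm1At_famV_of_prop7_prop8_sectF`, F-n07e-1) with «minimal ⇒ critical» supplied by `Node00.hcrit_pinCrit`.  The ONLY
hypotheses are the three printed statements over `famXOfRecord F N ζ.pinCrit` (whose «critical» is print's) and `0 < B₃`, `0 < C₁`; the family `famVOfRecord F N ζ` does not read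
the pinned slot. [cite: Balaban1985Variational, Thm 1 p.279; Prop. 7 p.299; Prop. 8 p.304; p.304 («Now we define a₁ …»); Sect. F (169) p.305] -/
theorem exists_thm1At_famV_pinCrit_of_prop7_prop8_sectF (hB₃ : 0 < ζ.B₃) (hC₁ : 0 < ζ.C₁)
    (p7 : B11.Prop7Printed ζ.B₃ ζ.C₁ (famXOfRecord F N ζ.pinCrit)) (p8 : B11.Prop8Printed ζ.B₃ (famXOfRecord F N ζ.pinCrit))
    (sF : B11.SectFPrinted ζ.B₃ (famXOfRecord F N ζ.pinCrit)) :
    ∃ C : B11Thm1.Consts, C.B₃ = ζ.B₃ ∧ ∀ i : ZIdx, Thm1At C (famVOfRecord F N ζ i) :=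
  exists_thm1At_famV_of_prop7_prop8_sectF ζ.pinCrit hB₃ hC₁ (hcrit_pinCrit ζ) p7 p8 sF

/-- **… as `B11.Thm1Printed` over the bundle of record's Theorem-1 family at the pinned layer** (the leaf's `t1` conjunct from Props 7, 8, Sect. F alone).
[cite: Balaban1985Variational, Thm 1 p.279, Props 7–8 pp.299–304, Sect. F p.305] -/
theorem thm1Printed_Z11OfRecord_pinCrit_of_prop7_prop8_sectF (hB₃ : 0 < ζ.B₃) (hC₁ : 0 < ζ.C₁)
    (p7 : B11.Prop7Printed ζ.B₃ ζ.C₁ (famXOfRecord F N ζ.pinCrit)) (p8 : B11.Prop8Printed ζ.B₃ (famXOfRecord F N ζ.pinCrit))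
    (sF : B11.SectFPrinted ζ.B₃ (famXOfRecord F N ζ.pinCrit)) : B11.Thm1Printed (Z11OfRecord F N ζ.pinCrit).famV :=
  thm1Printed_Z11OfRecord_of_prop7_prop8_sectF ζ.pinCrit hB₃ hC₁ (hcrit_pinCrit ζ) p7 p8 sF

/-- **THEOREM 1 OVER THE FAMILY ⇐ PROPOSITION 7 ∧ THE LOCATED LEAVES OF SECT. F, at the pinned layer** (Prop 8 and the Sect.-F conclusion from r08's `B11SectFAssembly` leaves) —
NO `hloc`, NO `hcrit`. [cite: Balaban1985Variational, Thm 1 p.279, Prop. 7 p.299, Prop. 8 p.304, Sect. F (144)–(169) pp.300–305] -/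
theorem thm1Printed_Z11OfRecord_pinCrit_of_prop7_leaves (Dc : ∀ i : ZIdx, CubeData (famXOfRecord F N ζ.pinCrit i))
    {d L B₁ B₂ K R₁M₁ c₁ a₃ a₄ : ℝ} (hLv : ∀ i, Leaves (famXOfRecord F N ζ.pinCrit i) (Dc i) d L B₁ B₂ ζ.B₃ K R₁M₁ c₁ a₃ a₄)
    (hd : 1 ≤ d) (hL : 0 < L) (hB₁ : 0 < B₁) (hB₂ : 0 < B₂) (hB₃ : 0 < ζ.B₃) (hK : 0 < K) (hR : 1 ≤ R₁M₁) (hc₁ : 0 < c₁) (ha₃ : 0 < a₃)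
    (ha₄ : 0 < a₄) (hC₁ : 0 < ζ.C₁) (p7 : B11.Prop7Printed ζ.B₃ ζ.C₁ (famXOfRecord F N ζ.pinCrit)) :
    B11.Thm1Printed (Z11OfRecord F N ζ.pinCrit).famV :=
  thm1Printed_Z11OfRecord_of_prop7_leaves_noLoc ζ.pinCrit Dc hLv hd hL hB₁ hB₂ hB₃ hK hR hc₁ ha₃ ha₄ hC₁ (hcrit_pinCrit ζ) p7

/-- **THE [B11] LEAF AT THE BUNDLE OF RECORD `Z11OfRecord F N ζ.pinCrit` FROM THE NINE PRINTED PARTS — NOTHING ELSE** (`t1` derived by §1; `hloc`, `hcrit` gone).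
[cite: Balaban1985Variational, Thm 1 p.279, Props 2–9 pp.281–309] -/
theorem b11Leaf_Z11OfRecord_pinCrit_of_parts (hB₃ : 0 < ζ.B₃) (hC₁ : 0 < ζ.C₁)
    (p2 : B11.Prop2Printed ζ.B₁ ζ.B₃ ζ.C₁ ζ.c₁ ζ.famLG) (p3 : B11.Prop3Printed ζ.C₁ ζ.B₃ ζ.C₂ ζ.C₃ ζ.B₀ ζ.c1h ζ.c₄ ζ.δ₀ ζ.famLG)
    (p4 : B11.Prop4Printed ζ.C₁ ζ.B₃ ζ.famLG) (p5 : B11.Prop5Printed ζ.B₁ ζ.B₃ ζ.C₁ ζ.famLG) (p6 : B11.Prop6Printed ζ.B₀ ζ.B₃ ζ.C₁ ζ.famLG)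
    (p7 : B11.Prop7Printed ζ.B₃ ζ.C₁ (famXOfRecord F N ζ.pinCrit)) (p8 : B11.Prop8Printed ζ.B₃ (famXOfRecord F N ζ.pinCrit))
    (sF : B11.SectFPrinted ζ.B₃ (famXOfRecord F N ζ.pinCrit)) (p9 : B11.Prop9Printed ζ.B₅ ζ.C₁ ζ.β₀ ζ.δ₀ ζ.famAn) :
    B11Leaf (Z11OfRecord F N ζ.pinCrit) :=
  b11Leaf_Z11OfRecord_of_parts_noLoc ζ.pinCrit hB₃ hC₁ (hcrit_pinCrit ζ) p2 p3 p4 p5 p6 p7 p8 sF p9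

/-- **THE [B11] LEAF AT `Z11OfRecord F N ζ.pinCrit` FROM PROPS 2–7, 9 AND THE LOCATED LEAVES OF SECT. F — NOTHING ELSE.**
[cite: Balaban1985Variational, Thm 1 p.279, Props 2–9 pp.281–309, Sect. F (144)–(169) pp.300–305] -/
theorem b11Leaf_Z11OfRecord_pinCrit_of_prop7_leaves (Dc : ∀ i : ZIdx, CubeData (famXOfRecord F N ζ.pinCrit i)) {d L B₂ K R₁M₁ a₃ a₄ : ℝ}
    (hLv : ∀ i, Leaves (famXOfRecord F N ζ.pinCrit i) (Dc i) d L ζ.B₁ B₂ ζ.B₃ K R₁M₁ ζ.c₁ a₃ a₄)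
    (hd : 1 ≤ d) (hL : 0 < L) (hB₂ : 0 < B₂) (hK : 0 < K) (hR : 1 ≤ R₁M₁) (ha₃ : 0 < a₃) (ha₄ : 0 < a₄)
    (hB₁ : 0 < ζ.B₁) (hB₃ : 0 < ζ.B₃) (hC₁ : 0 < ζ.C₁) (hc₁ : 0 < ζ.c₁)
    (p2 : B11.Prop2Printed ζ.B₁ ζ.B₃ ζ.C₁ ζ.c₁ ζ.famLG) (p3 : B11.Prop3Printed ζ.C₁ ζ.B₃ ζ.C₂ ζ.C₃ ζ.B₀ ζ.c1h ζ.c₄ ζ.δ₀ ζ.famLG)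
    (p4 : B11.Prop4Printed ζ.C₁ ζ.B₃ ζ.famLG) (p5 : B11.Prop5Printed ζ.B₁ ζ.B₃ ζ.C₁ ζ.famLG) (p6 : B11.Prop6Printed ζ.B₀ ζ.B₃ ζ.C₁ ζ.famLG)
    (p7 : B11.Prop7Printed ζ.B₃ ζ.C₁ (famXOfRecord F N ζ.pinCrit)) (p9 : B11.Prop9Printed ζ.B₅ ζ.C₁ ζ.β₀ ζ.δ₀ ζ.famAn) :
    B11Leaf (Z11OfRecord F N ζ.pinCrit) :=
  b11Leaf_Z11OfRecord_of_prop7_leaves_noLoc ζ.pinCrit Dc hLv hd hL hB₂ hK hR ha₃ ha₄ hB₁ hB₃ hC₁ hc₁ (hcrit_pinCrit ζ) p2 p3 p4 p5 p6 p7 p9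

end Prop7Dag

/-- **THE STAGE-11 CONSUMER, END TO END, AT THE CRIT-PINNED LAYER** — Props 2–7, 9 + the located leaves of Sect. F at `ζ.pinCrit` ⇒ N07 HOLDS at every run of a ₁₁CB10YZW record over
`datumOfRecord₁₁ θ h` presented with the layer `ζ.pinCrit` (junk-ops presentation of n07-a's `exists_record₁₁CB10YZW_b11_main_iff_leaf`; ∃-currency at a NAMED layer, NOT a
discharge). NO `hloc`, NO `hcrit`. [cite: Balaban1985Variational, Thm 1 p.279, Props 2–9 pp.281–309, Sect. F pp.300–305] -/
theorem exists_record₁₁CB10YZW_b11_main_pinCrit_of_prop7_leaves (θ : Stage11Params F N) (h : θ.Provisos₁₁) (hθ : θ.Admissible)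
    (hγ : 0 < θ.γ) (Mstar : ℕ) (lamW : ResidW F N) (ζ : ResidZ F N) (Dc : ∀ i : ZIdx, CubeData (famXOfRecord F N ζ.pinCrit i))
    {d L B₂ K R₁M₁ a₃ a₄ : ℝ} (hLv : ∀ i, Leaves (famXOfRecord F N ζ.pinCrit i) (Dc i) d L ζ.B₁ B₂ ζ.B₃ K R₁M₁ ζ.c₁ a₃ a₄)
    (hd : 1 ≤ d) (hL : 0 < L) (hB₂ : 0 < B₂) (hK : 0 < K) (hR : 1 ≤ R₁M₁) (ha₃ : 0 < a₃) (ha₄ : 0 < a₄)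
    (hB₁ : 0 < ζ.B₁) (hB₃ : 0 < ζ.B₃) (hC₁ : 0 < ζ.C₁) (hc₁ : 0 < ζ.c₁)
    (p2 : B11.Prop2Printed ζ.B₁ ζ.B₃ ζ.C₁ ζ.c₁ ζ.famLG) (p3 : B11.Prop3Printed ζ.C₁ ζ.B₃ ζ.C₂ ζ.C₃ ζ.B₀ ζ.c1h ζ.c₄ ζ.δ₀ ζ.famLG)
    (p4 : B11.Prop4Printed ζ.C₁ ζ.B₃ ζ.famLG) (p5 : B11.Prop5Printed ζ.B₁ ζ.B₃ ζ.C₁ ζ.famLG) (p6 : B11.Prop6Printed ζ.B₀ ζ.B₃ ζ.C₁ ζ.famLG)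
    (p7 : B11.Prop7Printed ζ.B₃ ζ.C₁ (famXOfRecord F N ζ.pinCrit)) (p9 : B11.Prop9Printed ζ.B₅ ζ.C₁ ζ.β₀ ζ.δ₀ ζ.famAn) :
    ∃ w : WorldP, IsRecordOfRecord₁₁CB10YZW F N (datumOfRecord₁₁ F N θ h) w ∧ ∀ P : B12.RunParams, Dag.B11_main (leavesP w P) :=
  exists_record₁₁CB10YZW_b11_main_of_prop7_leaves_noLoc θ h hθ hγ Mstar lamW ζ.pinCrit Dc hLv hd hL hB₂ hK hR ha₃ ha₄ hB₁ hB₃ hC₁ hc₁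
    (hcrit_pinCrit ζ) p2 p3 p4 p5 p6 p7 p9

/-! ## §2 The repaired two-tier tower at the crit-pinned layer: Thm 1 and Prop 7 derived from Props 2, 5, 6, 8, Sect. F and the located bridge steps — NOTHING ELSE -/

section Tower

variable (ζ : ResidZ F N)

/-- ★ **THEOREM 1 AT EVERY MEMBER OF THE FAMILY OF RECORD (ONE BLOCK OF CONSTANTS, `B₃″ = κ₀B₃`) AND THE BACKGROUND-FREE PROPOSITION 7 OVER `famXOfRecord F N ζ.pinCrit`, BY THE
REPAIRED SECT.-A INDUCTION — NO `hloc`, NO `hcrit`**: this seat's `thm1At_prop7_famOfRecord_of_towerT_parts_noLoc` (p458798; seat -d's tower of record p455032 on the one-sided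
dictionary p458026) at `ζ.pinCrit` with «minimal ⇒ critical» supplied by `Node00.hcrit_pinCrit`.  DISPLAYED: the bridges `β`, `bg`, `hbg14`, `Bridge.Laws`, `ExistenceLeavesCap`
((15)–(18) p. 280, (112)–(142) pp. 294–299 — their «critical» is print's), the printed constant relations, Props 2, 5, 6 over `ζ.famLG`, Prop 8 and Sect. F over
`famXOfRecord F N ζ.pinCrit` at `B₃`. [cite: Balaban1985Variational, Thm 1 p.279, Sect. A (11)–(14) pp.279–280, Prop. 7 p.299, Prop. 8 p.304, Sect. F (169) p.305] -/
theorem thm1At_prop7_famOfRecord_pinCrit_of_towerT_parts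
    (β : ∀ i : ZIdx, Bridge (famXOfRecord F N ζ.pinCrit i) (ζ.famLG i)) (bg : ∀ i : ZIdx, GaugeField (F.P i.K) 0 (SU N) → (ζ.famLG i).Cfg)
    {κ₀ B₃ O₁ O₂ e₅ : ℝ}
    (hbg14 : ∀ (i : ZIdx) (ε : ℝ) (V : GaugeField (F.P i.K) i.k (SU N)) (U : GaugeField (F.P i.K) 0 (SU N)),
      InUkClassB11 F N i.K i.k (ζ.C₁ * B₃ * ε) U → Averaging.iter (avOfRecord F N i.K) i.k U = V →
        (ζ.famLG i).Sat14 (ζ.C₁ * B₃ * ε) (ζ.C₁ * ε) ((β i).bdry V) (bg i U))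
    (laws : ∀ i, (β i).Laws ζ.C₁ B₃) (leaves : ∀ i, ExistenceLeavesCap (β i) ζ.B₀ B₃ ζ.C₁ O₁ O₂ e₅)
    (hκ₀ : 1 ≤ κ₀) (hB₀ : 0 < ζ.B₀) (hB₁ : 0 < ζ.B₁) (hB₃ : 1 ≤ B₃) (hC₁L : (F.L : ℝ) ^ 3 ≤ ζ.C₁) (hB₀B₁ : ζ.B₀ ≤ 4 * ζ.B₁)
    (hc₁ : 0 < ζ.c₁) (hO₁ : 0 < O₁) (hO₂ : 0 < O₂) (he₅ : 0 < e₅)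
    (p2 : B11.Prop2Printed ζ.B₁ B₃ ζ.C₁ ζ.c₁ ζ.famLG) (p5 : B11.Prop5Printed ζ.B₁ B₃ ζ.C₁ ζ.famLG) (p6 : B11.Prop6Printed ζ.B₀ B₃ ζ.C₁ ζ.famLG)
    (p8 : B11.Prop8Printed B₃ (famXOfRecord F N ζ.pinCrit)) (sF : B11.SectFPrinted B₃ (famXOfRecord F N ζ.pinCrit)) :
    (∃ C : B11Thm1.Consts, C.B₃ = B₃ * κ₀ ∧ ∀ i : ZIdx, Thm1At C (varProblemT F N i.K i.k (ζ.R i))) ∧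
      B11.Prop7Printed (B₃ * κ₀) ζ.C₁ (famXOfRecord F N ζ.pinCrit) :=
  thm1At_prop7_famOfRecord_of_towerT_parts_noLoc ζ.pinCrit β bg hbg14 laws leaves (hcrit_pinCrit ζ) hκ₀ hB₀ hB₁ hB₃ hC₁L hB₀B₁ hc₁ hO₁ hO₂ he₅
    p2 p5 p6 p8 sF

/-- **THE [B11] LEAF AT `Z11OfRecord F N ζ.pinCrit` FROM THE TOWER PARTS** (`ζ.B₃ = B₃κ₀`): `t1` and `p7` DERIVED by the repaired induction (above); the leaf's own Props 2, 3, 4, 5, 6, 8,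
Sect. F at `ζ.B₃` and Prop 9 verbatim — NO `hloc`, NO `hcrit`. [cite: Balaban1985Variational, Thm 1 p.279, Props 2–9 pp.281–309, Sect. A pp.279–280] -/
theorem b11Leaf_Z11OfRecord_pinCrit_of_towerT_parts
    (β : ∀ i : ZIdx, Bridge (famXOfRecord F N ζ.pinCrit i) (ζ.famLG i)) (bg : ∀ i : ZIdx, GaugeField (F.P i.K) 0 (SU N) → (ζ.famLG i).Cfg)
    {κ₀ B₃ O₁ O₂ e₅ : ℝ}
    (hbg14 : ∀ (i : ZIdx) (ε : ℝ) (V : GaugeField (F.P i.K) i.k (SU N)) (U : GaugeField (F.P i.K) 0 (SU N)),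
      InUkClassB11 F N i.K i.k (ζ.C₁ * B₃ * ε) U → Averaging.iter (avOfRecord F N i.K) i.k U = V →
        (ζ.famLG i).Sat14 (ζ.C₁ * B₃ * ε) (ζ.C₁ * ε) ((β i).bdry V) (bg i U))
    (laws : ∀ i, (β i).Laws ζ.C₁ B₃) (leaves : ∀ i, ExistenceLeavesCap (β i) ζ.B₀ B₃ ζ.C₁ O₁ O₂ e₅)
    (hκ₀ : 1 ≤ κ₀) (hB₀ : 0 < ζ.B₀) (hB₁ : 0 < ζ.B₁) (hB₃ : 1 ≤ B₃) (hC₁L : (F.L : ℝ) ^ 3 ≤ ζ.C₁) (hB₀B₁ : ζ.B₀ ≤ 4 * ζ.B₁)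
    (hc₁ : 0 < ζ.c₁) (hO₁ : 0 < O₁) (hO₂ : 0 < O₂) (he₅ : 0 < e₅)
    (p2 : B11.Prop2Printed ζ.B₁ B₃ ζ.C₁ ζ.c₁ ζ.famLG) (p5 : B11.Prop5Printed ζ.B₁ B₃ ζ.C₁ ζ.famLG) (p6 : B11.Prop6Printed ζ.B₀ B₃ ζ.C₁ ζ.famLG)
    (p8 : B11.Prop8Printed B₃ (famXOfRecord F N ζ.pinCrit)) (sF : B11.SectFPrinted B₃ (famXOfRecord F N ζ.pinCrit)) (hζ : ζ.B₃ = B₃ * κ₀)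
    (q2 : B11.Prop2Printed ζ.B₁ ζ.B₃ ζ.C₁ ζ.c₁ ζ.famLG) (q3 : B11.Prop3Printed ζ.C₁ ζ.B₃ ζ.C₂ ζ.C₃ ζ.B₀ ζ.c1h ζ.c₄ ζ.δ₀ ζ.famLG)
    (q4 : B11.Prop4Printed ζ.C₁ ζ.B₃ ζ.famLG) (q5 : B11.Prop5Printed ζ.B₁ ζ.B₃ ζ.C₁ ζ.famLG) (q6 : B11.Prop6Printed ζ.B₀ ζ.B₃ ζ.C₁ ζ.famLG)
    (q8 : B11.Prop8Printed ζ.B₃ (famXOfRecord F N ζ.pinCrit)) (qF : B11.SectFPrinted ζ.B₃ (famXOfRecord F N ζ.pinCrit))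
    (p9 : B11.Prop9Printed ζ.B₅ ζ.C₁ ζ.β₀ ζ.δ₀ ζ.famAn) :
    B11Leaf (Z11OfRecord F N ζ.pinCrit) :=
  b11Leaf_Z11OfRecord_of_towerT_parts_noLoc ζ.pinCrit β bg hbg14 laws leaves (hcrit_pinCrit ζ) hκ₀ hB₀ hB₁ hB₃ hC₁L hB₀B₁ hc₁ hO₁ hO₂ he₅
    p2 p5 p6 p8 sF hζ q2 q3 q4 q5 q6 q8 qF p9

/-- **N07 AT THE ₁₁ CARRIER RECORD FROM THE TOWER PARTS AT THE CRIT-PINNED LAYER** (∃-direction through seat -d's `exists_record₁₁CB10YZW_b11_main_of_leaf`; junk in-edges, NOT a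
discharge) — NO `hloc`, NO `hcrit`. [cite: Balaban1985Variational, Thm 1 p.279, Props 2–9 pp.281–309, Sect. A pp.279–280] -/
theorem exists_record₁₁CB10YZW_b11_main_pinCrit_of_towerT_parts
    (β : ∀ i : ZIdx, Bridge (famXOfRecord F N ζ.pinCrit i) (ζ.famLG i)) (bg : ∀ i : ZIdx, GaugeField (F.P i.K) 0 (SU N) → (ζ.famLG i).Cfg)
    {κ₀ B₃ O₁ O₂ e₅ : ℝ}
    (hbg14 : ∀ (i : ZIdx) (ε : ℝ) (V : GaugeField (F.P i.K) i.k (SU N)) (U : GaugeField (F.P i.K) 0 (SU N)),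
      InUkClassB11 F N i.K i.k (ζ.C₁ * B₃ * ε) U → Averaging.iter (avOfRecord F N i.K) i.k U = V →
        (ζ.famLG i).Sat14 (ζ.C₁ * B₃ * ε) (ζ.C₁ * ε) ((β i).bdry V) (bg i U))
    (laws : ∀ i, (β i).Laws ζ.C₁ B₃) (leaves : ∀ i, ExistenceLeavesCap (β i) ζ.B₀ B₃ ζ.C₁ O₁ O₂ e₅)
    (hκ₀ : 1 ≤ κ₀) (hB₀ : 0 < ζ.B₀) (hB₁ : 0 < ζ.B₁) (hB₃ : 1 ≤ B₃) (hC₁L : (F.L : ℝ) ^ 3 ≤ ζ.C₁) (hB₀B₁ : ζ.B₀ ≤ 4 * ζ.B₁)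
    (hc₁ : 0 < ζ.c₁) (hO₁ : 0 < O₁) (hO₂ : 0 < O₂) (he₅ : 0 < e₅)
    (p2 : B11.Prop2Printed ζ.B₁ B₃ ζ.C₁ ζ.c₁ ζ.famLG) (p5 : B11.Prop5Printed ζ.B₁ B₃ ζ.C₁ ζ.famLG) (p6 : B11.Prop6Printed ζ.B₀ B₃ ζ.C₁ ζ.famLG)
    (p8 : B11.Prop8Printed B₃ (famXOfRecord F N ζ.pinCrit)) (sF : B11.SectFPrinted B₃ (famXOfRecord F N ζ.pinCrit))
    (hζ : ζ.B₃ = B₃ * κ₀) (θ : Stage11Params F N) (h : θ.Provisos₁₁) (hθ : θ.Admissible)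
    (hγ : 0 < θ.γ) (Mstar : ℕ) (ops : OpsY N θ.toStage3Params Mstar) (lamW : ResidW F N)
    (q2 : B11.Prop2Printed ζ.B₁ ζ.B₃ ζ.C₁ ζ.c₁ ζ.famLG) (q3 : B11.Prop3Printed ζ.C₁ ζ.B₃ ζ.C₂ ζ.C₃ ζ.B₀ ζ.c1h ζ.c₄ ζ.δ₀ ζ.famLG)
    (q4 : B11.Prop4Printed ζ.C₁ ζ.B₃ ζ.famLG) (q5 : B11.Prop5Printed ζ.B₁ ζ.B₃ ζ.C₁ ζ.famLG) (q6 : B11.Prop6Printed ζ.B₀ ζ.B₃ ζ.C₁ ζ.famLG)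
    (q8 : B11.Prop8Printed ζ.B₃ (famXOfRecord F N ζ.pinCrit)) (qF : B11.SectFPrinted ζ.B₃ (famXOfRecord F N ζ.pinCrit))
    (p9 : B11.Prop9Printed ζ.B₅ ζ.C₁ ζ.β₀ ζ.δ₀ ζ.famAn) :
    ∃ w : WorldP, IsRecordOfRecord₁₁CB10YZW F N (datumOfRecord₁₁ F N θ h) w ∧ ∀ P : B12.RunParams, Dag.B11_main (leavesP w P) :=
  exists_record₁₁CB10YZW_b11_main_of_towerT_parts_noLoc ζ.pinCrit β bg hbg14 laws leaves (hcrit_pinCrit ζ) hκ₀ hB₀ hB₁ hB₃ hC₁L hB₀B₁ hc₁ hO₁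
    hO₂ he₅ p2 p5 p6 p8 sF hζ θ h hθ hγ Mstar ops lamW q2 q3 q4 q5 q6 q8 qF p9

/-- **THE PRINTED TOWER AT THE TORUS OF RECORD (κ₀ = 1), CRIT-PINNED LAYER**: the [B11] leaf at `Z11OfRecord F N ζ.pinCrit` with EVERY printed statement at the ONE constant `ζ.B₃` —
Theorem 1 and Proposition 7 derived by the induction, Props 2–6, 8, 9, Sect. F verbatim, the located bridge steps displayed, Sect. A and the WHOLE dictionary PROVED — NO `hloc`,
NO `hcrit`. [cite: Balaban1985Variational, Thm 1 p.279, Sect. A (11)–(14) pp.279–280, Props 2–9 pp.281–309] -/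
theorem b11Leaf_Z11OfRecord_pinCrit_of_towerT_parts_kappa_one
    (β : ∀ i : ZIdx, Bridge (famXOfRecord F N ζ.pinCrit i) (ζ.famLG i)) (bg : ∀ i : ZIdx, GaugeField (F.P i.K) 0 (SU N) → (ζ.famLG i).Cfg)
    {O₁ O₂ e₅ : ℝ}
    (hbg14 : ∀ (i : ZIdx) (ε : ℝ) (V : GaugeField (F.P i.K) i.k (SU N)) (U : GaugeField (F.P i.K) 0 (SU N)),
      InUkClassB11 F N i.K i.k (ζ.C₁ * ζ.B₃ * ε) U → Averaging.iter (avOfRecord F N i.K) i.k U = V →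
        (ζ.famLG i).Sat14 (ζ.C₁ * ζ.B₃ * ε) (ζ.C₁ * ε) ((β i).bdry V) (bg i U))
    (laws : ∀ i, (β i).Laws ζ.C₁ ζ.B₃) (leaves : ∀ i, ExistenceLeavesCap (β i) ζ.B₀ ζ.B₃ ζ.C₁ O₁ O₂ e₅)
    (hB₀ : 0 < ζ.B₀) (hB₁ : 0 < ζ.B₁) (hB₃ : 1 ≤ ζ.B₃) (hC₁L : (F.L : ℝ) ^ 3 ≤ ζ.C₁) (hB₀B₁ : ζ.B₀ ≤ 4 * ζ.B₁)
    (hc₁ : 0 < ζ.c₁) (hO₁ : 0 < O₁) (hO₂ : 0 < O₂) (he₅ : 0 < e₅)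
    (p2 : B11.Prop2Printed ζ.B₁ ζ.B₃ ζ.C₁ ζ.c₁ ζ.famLG) (p3 : B11.Prop3Printed ζ.C₁ ζ.B₃ ζ.C₂ ζ.C₃ ζ.B₀ ζ.c1h ζ.c₄ ζ.δ₀ ζ.famLG)
    (p4 : B11.Prop4Printed ζ.C₁ ζ.B₃ ζ.famLG) (p5 : B11.Prop5Printed ζ.B₁ ζ.B₃ ζ.C₁ ζ.famLG) (p6 : B11.Prop6Printed ζ.B₀ ζ.B₃ ζ.C₁ ζ.famLG)
    (p8 : B11.Prop8Printed ζ.B₃ (famXOfRecord F N ζ.pinCrit)) (sF : B11.SectFPrinted ζ.B₃ (famXOfRecord F N ζ.pinCrit))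
    (p9 : B11.Prop9Printed ζ.B₅ ζ.C₁ ζ.β₀ ζ.δ₀ ζ.famAn) :
    B11Leaf (Z11OfRecord F N ζ.pinCrit) :=
  b11Leaf_Z11OfRecord_of_towerT_parts_kappa_one_noLoc ζ.pinCrit β bg hbg14 laws leaves (hcrit_pinCrit ζ) hB₀ hB₁ hB₃ hC₁L hB₀B₁ hc₁ hO₁ hO₂ he₅
    p2 p3 p4 p5 p6 p8 sF p9

end Tower

/-! ## §3 The doubly-pinned layer `(ζ.withSectE E).pinCrit`: Sect. E presented (p4, p6 theorems) AND «critical» pinned (`hcrit` a theorem) -/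

section Doubly

variable {L : ℝ} {η : ZIdx → ℝ} [Fact (0 < L)] [∀ i, Fact (0 < η i)] {β : ZIdx → Type} [∀ i, Fintype (β i)]

/-- The two refinements of the residual layer touch DISJOINT fields: at `(ζ.withSectE E).pinCrit` the Props 2–6 family is def-B11's Sect.-E family and the criticality slot is
the predicate of record (both `rfl`). [cite: Balaban1985Variational, Props 2–8 pp.281–304 (bookkeeping)] -/
theorem withSectE_pinCrit_faces (ζ : ResidZ F N) (E : SectEPres F N L η β ζ) :
    ((ζ.withSectE E).pinCrit).famLG = (ζ.withSectE E).famLG ∧ (∀ i : ZIdx, ((ζ.withSectE E).pinCrit).IsCrit i = IsCritOfRecord F N i.K i.k) ∧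
      ((ζ.withSectE E).pinCrit).R = ζ.R ∧ ((ζ.withSectE E).pinCrit).famAn = ζ.famAn :=
  ⟨rfl, fun _ => rfl, rfl, rfl⟩

/-- ★ **THE [B11] LEAF AT THE DOUBLY-PINNED BUNDLE OF RECORD `Z11OfRecord F N (ζ.withSectE E).pinCrit` FROM SEVEN PRINTED STATEMENTS — Props 2, 3, 5 (over the Sect.-E family),
Props 7, 8, Sect. F (over the Props 7–8 family, «critical» = print's), Prop. 9 — and the positivity of the letters; NOTHING ELSE**: `t1` by §1 (p. 304's assembly, `hcrit` by
`Node00.hcrit_pinCrit`, no `hloc`), p4 and p6 by node00-def-B11's `prop4∕prop6_Z11OfRecord_withSectE` (n07-b's Sect. E at objects, n16-d's knit).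
[cite: Balaban1985Variational, Thm 1 p.279, Props 2–9 pp.281–309] -/
theorem b11Leaf_Z11OfRecord_withSectE_pinCrit_of_parts (ζ : ResidZ F N) (E : SectEPres F N L η β ζ)
    (hC₄ : 0 < E.C₄) (ha₃ : 0 < E.a₃) (hα : 0 < E.α) (hB₀ : 0 < ζ.B₀) (hB₃ : 0 < ζ.B₃) (hC₁ : 0 < ζ.C₁)
    (p2 : B11.Prop2Printed ζ.B₁ ζ.B₃ ζ.C₁ ζ.c₁ (ζ.withSectE E).famLG) (p3 : B11.Prop3Printed ζ.C₁ ζ.B₃ ζ.C₂ ζ.C₃ ζ.B₀ ζ.c1h ζ.c₄ ζ.δ₀ (ζ.withSectE E).famLG)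
    (p5 : B11.Prop5Printed ζ.B₁ ζ.B₃ ζ.C₁ (ζ.withSectE E).famLG)
    (p7 : B11.Prop7Printed ζ.B₃ ζ.C₁ (famXOfRecord F N (ζ.withSectE E).pinCrit)) (p8 : B11.Prop8Printed ζ.B₃ (famXOfRecord F N (ζ.withSectE E).pinCrit))
    (sF : B11.SectFPrinted ζ.B₃ (famXOfRecord F N (ζ.withSectE E).pinCrit)) (p9 : B11.Prop9Printed ζ.B₅ ζ.C₁ ζ.β₀ ζ.δ₀ ζ.famAn) :
    B11Leaf (Z11OfRecord F N (ζ.withSectE E).pinCrit) :=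
  b11Leaf_Z11OfRecord_of_parts_noLoc (ζ.withSectE E).pinCrit hB₃ hC₁ (hcrit_pinCrit _) p2 p3 (prop4_Z11OfRecord_withSectE ζ E hC₄ ha₃ hB₃ hα hC₁) p5
    (prop6_Z11OfRecord_withSectE ζ E hB₀ hC₄ ha₃ hB₃ hα hC₁) p7 p8 sF p9

/-- **THE STAGE-11 CONSUMER AT THE DOUBLY-PINNED LAYER** — the seven printed statements at `(ζ.withSectE E).pinCrit` ⇒ N07 HOLDS at every run of a ₁₁CB10YZW record over `datumOfRecord₁₁ θ h`
presented with that layer (∃-currency at a NAMED layer; junk-ops presentation; NOT a discharge). [cite: Balaban1985Variational, Thm 1 p.279, Props 2–9 pp.281–309] -/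
theorem exists_record₁₁CB10YZW_b11_main_withSectE_pinCrit_of_parts (θ : Stage11Params F N) (h : θ.Provisos₁₁) (hθ : θ.Admissible) (hγ : 0 < θ.γ) (Mstar : ℕ)
    (ops : OpsY N θ.toStage3Params Mstar) (lamW : ResidW F N) (ζ : ResidZ F N) (E : SectEPres F N L η β ζ)
    (hC₄ : 0 < E.C₄) (ha₃ : 0 < E.a₃) (hα : 0 < E.α) (hB₀ : 0 < ζ.B₀) (hB₃ : 0 < ζ.B₃) (hC₁ : 0 < ζ.C₁)
    (p2 : B11.Prop2Printed ζ.B₁ ζ.B₃ ζ.C₁ ζ.c₁ (ζ.withSectE E).famLG) (p3 : B11.Prop3Printed ζ.C₁ ζ.B₃ ζ.C₂ ζ.C₃ ζ.B₀ ζ.c1h ζ.c₄ ζ.δ₀ (ζ.withSectE E).famLG)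
    (p5 : B11.Prop5Printed ζ.B₁ ζ.B₃ ζ.C₁ (ζ.withSectE E).famLG)
    (p7 : B11.Prop7Printed ζ.B₃ ζ.C₁ (famXOfRecord F N (ζ.withSectE E).pinCrit)) (p8 : B11.Prop8Printed ζ.B₃ (famXOfRecord F N (ζ.withSectE E).pinCrit))
    (sF : B11.SectFPrinted ζ.B₃ (famXOfRecord F N (ζ.withSectE E).pinCrit)) (p9 : B11.Prop9Printed ζ.B₅ ζ.C₁ ζ.β₀ ζ.δ₀ ζ.famAn) :
    ∃ w : WorldP, IsRecordOfRecord₁₁CB10YZW F N (datumOfRecord₁₁ F N θ h) w ∧ ∀ P : B12.RunParams, Dag.B11_main (leavesP w P) :=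
  N07AtRecordTwoTier.exists_record₁₁CB10YZW_b11_main_of_leaf θ h hθ hγ Mstar ops _ lamW
    (b11Leaf_Z11OfRecord_withSectE_pinCrit_of_parts ζ E hC₄ ha₃ hα hB₀ hB₃ hC₁ p2 p3 p5 p7 p8 sF p9)

/-- ★ **THE PRINTED TOWER (κ₀ = 1) AT THE DOUBLY-PINNED LAYER — THE [B11] LEAF FROM PROPS 2, 3, 5, 8, SECT. F, PROP. 9, THE LOCATED BRIDGE STEPS AND THE CONSTANT RELATIONS; NOTHING ELSE**:
Theorem 1 AND Proposition 7 DERIVED by the repaired Sect.-A induction (§2, tower of record at `V₀ := faceSec`), p4 ∕ p6 by node00-def-B11's Sect.-E theorems, `hcrit` by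
`Node00.hcrit_pinCrit`, `hloc` absent; displayed: the bridges `β`, `bg`, `hbg14`, `Bridge.Laws`, `ExistenceLeavesCap` ((15)–(18), (112)–(142)), `B₀ ≤ 4B₁`, `B₃ ≥ 1`, `C₁ ≥ L³`, the
Sect.-E letters' positivity, Props 2, 3, 5 over the Sect.-E family, Prop 8 + Sect. F over the Props 7–8 family, Prop. 9. [cite: Balaban1985Variational, Thm 1 p.279, Sect. A (11)–(14) pp.279–280, Props 2–9 pp.281–309] -/
theorem b11Leaf_Z11OfRecord_withSectE_pinCrit_of_towerT_parts_kappa_one (ζ : ResidZ F N) (E : SectEPres F N L η β ζ)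
    (hC₄ : 0 < E.C₄) (ha₃ : 0 < E.a₃) (hα : 0 < E.α)
    (βr : ∀ i : ZIdx, Bridge (famXOfRecord F N (ζ.withSectE E).pinCrit i) ((ζ.withSectE E).famLG i))
    (bg : ∀ i : ZIdx, GaugeField (F.P i.K) 0 (SU N) → ((ζ.withSectE E).famLG i).Cfg) {O₁ O₂ e₅ : ℝ}
    (hbg14 : ∀ (i : ZIdx) (ε : ℝ) (V : GaugeField (F.P i.K) i.k (SU N)) (U : GaugeField (F.P i.K) 0 (SU N)),
      InUkClassB11 F N i.K i.k (ζ.C₁ * ζ.B₃ * ε) U → Averaging.iter (avOfRecord F N i.K) i.k U = V →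
        ((ζ.withSectE E).famLG i).Sat14 (ζ.C₁ * ζ.B₃ * ε) (ζ.C₁ * ε) ((βr i).bdry V) (bg i U))
    (laws : ∀ i, (βr i).Laws ζ.C₁ ζ.B₃) (leaves : ∀ i, ExistenceLeavesCap (βr i) ζ.B₀ ζ.B₃ ζ.C₁ O₁ O₂ e₅)
    (hB₀ : 0 < ζ.B₀) (hB₁ : 0 < ζ.B₁) (hB₃ : 1 ≤ ζ.B₃) (hC₁L : (F.L : ℝ) ^ 3 ≤ ζ.C₁) (hB₀B₁ : ζ.B₀ ≤ 4 * ζ.B₁)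
    (hc₁ : 0 < ζ.c₁) (hO₁ : 0 < O₁) (hO₂ : 0 < O₂) (he₅ : 0 < e₅)
    (p2 : B11.Prop2Printed ζ.B₁ ζ.B₃ ζ.C₁ ζ.c₁ (ζ.withSectE E).famLG) (p3 : B11.Prop3Printed ζ.C₁ ζ.B₃ ζ.C₂ ζ.C₃ ζ.B₀ ζ.c1h ζ.c₄ ζ.δ₀ (ζ.withSectE E).famLG)
    (p5 : B11.Prop5Printed ζ.B₁ ζ.B₃ ζ.C₁ (ζ.withSectE E).famLG)
    (p8 : B11.Prop8Printed ζ.B₃ (famXOfRecord F N (ζ.withSectE E).pinCrit)) (sF : B11.SectFPrinted ζ.B₃ (famXOfRecord F N (ζ.withSectE E).pinCrit))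
    (p9 : B11.Prop9Printed ζ.B₅ ζ.C₁ ζ.β₀ ζ.δ₀ ζ.famAn) :
    B11Leaf (Z11OfRecord F N (ζ.withSectE E).pinCrit) := by
  have hB₃' : 0 < ζ.B₃ := lt_of_lt_of_le one_pos hB₃
  have hC₁ : 0 < ζ.C₁ := by
    have hL1 : (1 : ℝ) ≤ (F.L : ℝ) := by exact_mod_cast (F.P 0).L_pos
    exact lt_of_lt_of_le one_pos (le_trans (one_le_pow₀ (M₀ := ℝ) (n := 3) hL1) hC₁L)
  exact b11Leaf_Z11OfRecord_of_towerT_parts_kappa_one_noLoc (ζ.withSectE E).pinCrit βr bg hbg14 laws leaves (hcrit_pinCrit _) hB₀ hB₁ hB₃ hC₁L hB₀B₁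
    hc₁ hO₁ hO₂ he₅ p2 p3 (prop4_Z11OfRecord_withSectE ζ E hC₄ ha₃ hB₃' hα hC₁) p5 (prop6_Z11OfRecord_withSectE ζ E hB₀ hC₄ ha₃ hB₃' hα hC₁) p8 sF p9

end Doubly

end Summit.QuantumFields.YangMills.BalabanUVNodes.N07AtRecordCritPinned

end
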